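import Summits.BirchSwinnertonDyer.BirchSwinnertonDyer.Theorems.SmallImageMuTransferMuTransferX9KolyvaginClassTwist
import Summits.BirchSwinnertonDyer.Rank1Residual.X11b.MaxUnramifiedRestriction
import Literature.NumberTheory.GaloisRepresentations.DecompositionGroupOfCompletion
import Literature.NumberTheory.GaloisRepresentations.RestrictedRamification
import Literature.NumberTheory.EllipticCurves.KummerSelmerStructure
import HarnessLib

/-!
# K6 crux `MuTransferX9` (stmt-BirchSwinnertonDyer-19276), skeleton v6 stub `stub_stepsTwoFourOdd`:
# the Kolyvagin cocycle is UNRAMIFIED away from `q` — global form (vanishing on every inertia group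
# above `w`) and local form (`loc_w [Φ] ∈ H¹_ur(K_w, M)`)

Cell `bsd-smallim`, seat `bsd-smallim-k6-g3` (gen 0).  THEOREMS ONLY (no definition, no named fact,
no `sorry`); generic over a number field `K`.  HONEST FRAMING: helper toward the registered stub (the
clause "`loc_v κ_q ∈ H¹_ur ∀ v ∉ S₀ ∪ {q}`" of the G3/G4 meeting point, x10 p454438 `hx`); closes
nothing.  PARTITION (D-0054): X9 (A4) · X10b (A5) — helper; closes NONE.

MU-TRANSFER-PROOF §3 Lemma 2: "`κ_q` is unramified at every `ℓ ∤ pNq`: `I_ℓ ⊂ H`, `I_ℓ = I_λ`, and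
`𝐳̄_q` is unramified at `λ` [K-13.3: classes over `ℤ[ζ_q, 1/p]`]".  In the tree's currency: the
Kolyvagin cocycle `Φ` of `KolyvaginTwist.exists_kolyvaginCocycle(_rat)` restricts on
`N = Gal(K̄/K(μ_ℓ))` to the derivative cocycle `Σ_{i<n} i•σ^i·y`; at a place `w` where `N` is
unramified (`I_𝔓 ≤ N` for all `𝔓 ∣ w`, e.g. `w ∤ ℓ`, tree `rootsOfUnityFixer_unramifiedAt`) and where
`y` vanishes on EVERY inertia group above `w` (Kato's integrality `Kato2004.integralH1`, read through
p451028 `apply_eq_zero_of_resLe_inf_eq_zero`), each conjugate `σ^{-i} τ σ^i` of `τ ∈ I_𝔓` lies in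
`I_{σ^{-i}•𝔓}`, another inertia group above `w` (`conj_mem_inertia_smul`, `smul_mem_primesAbove`), so
`Φ(τ) = 0`.  Locally, `I_{𝔓₀} = res (I_{K_w})` for the distinguished prime
(`inertia_adicCompletionPrime_eq_map_absInertia`), and a cocycle vanishing on `I_{K_w}` has class in
`H¹_ur` (x11b `LocBridge.mem_unramifiedSubgroup_one_iff_exists`).

* `derivCocycle_apply_eq_zero_of_forall_primesAbove` — global: `Φ(τ) = 0` for `τ ∈ I_𝔓`, `𝔓 ∣ w`;
* `forall_primesAbove_apply_eq_zero_of_resLe_inf_eq_zero` — the input "`y` vanishes on every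
  `I_𝔓 ∩ N`" from the CLASS-level unramifiedness `res_{N ⊓ I_𝔓} [y] = 0` (inertia acting trivially);
* **`localization_mem_unramifiedSubgroup_of_forall_inertia_apply_eq_zero`** — local: a global
  cocycle vanishing on `I_{𝔓₀}` has `loc_w [Φ] ∈ DiscreteGaloisModule.unramifiedSubgroup (toLocal w ρ) 1`;
* **`localization_derivCocycle_mem_unramifiedSubgroup`** — the two combined for the Kolyvagin
  cocycle: `loc_w [Φ] ∈ H¹_ur(K_w, M)`.

References: HOME/koly/MU-TRANSFER-PROOF.md §3; K. Rubin, *Euler Systems* (2000) Thm. 4.5.1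
[Rubin2000]; B. Mazur, K. Rubin, *Kolyvagin systems* (2004) App. A Prop. A.2 [MazurRubin2004];
J. S. Milne, *Arithmetic Duality Theorems* (2006) I §2 [MilneADT2006]; J. Neukirch, *Algebraic
Number Theory* (1999) II §9 (9.6) [NeukirchANT1999].
-/

-- the summit and its single problem are both named `BirchSwinnertonDyer` (registry layout D-0017)
set_option linter.dupNamespace false
set_option autoImplicit false

noncomputable section

open CategoryTheory Function Finset
open scoped NumberField Pointwise
open Field IsDedekindDomain NumberField
open Literature.NumberTheory.GaloisRepresentations
open Literature.NumberTheory.GaloisRepresentations.IsNonarchimedeanLocalField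
open Literature.NumberTheory.EllipticCurves (subgroupConj subgroupConj_apply_coe)
open Summit.BirchSwinnertonDyer.Rank1Residual

universe u v

namespace Summit.BirchSwinnertonDyer.BirchSwinnertonDyer.Rank1Residual.KolyvaginTwist

/-! ### §1 Global: the derivative cocycle vanishes on every inertia group above `w` -/

section Global

variable {K : Type u} [Field K] [NumberField K]
variable {R : Type v} [CommRing R] [TopologicalSpace R]
variable (X : TopRep.{u} R (absoluteGaloisGroup K)) (N : Subgroup (absoluteGaloisGroup K)) [N.Normal]

omit [NumberField K] in
/-- **The Kolyvagin cocycle vanishes on every inertia group above a place `w` where its level is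
unramified and the input class is unramified** (global form of "`κ_q` unramified at `ℓ ∤ pNq`"):
if `I_𝔓 ≤ N` for every `𝔓 ∣ w`, `y` vanishes at every element of every such `I_𝔓`, and `Φ|_N` is
the derivative cocycle `Σ_{i<n} i•σ^i·y`, then `Φ(τ) = 0` for `τ ∈ I_𝔓`, `𝔓 ∣ w` — because
`σ^{-i} τ σ^i ∈ I_{σ^{-i}•𝔓}` with `σ^{-i}•𝔓 ∣ w`. [cite: Rubin2000, Thm. 4.5.1] -/
theorem derivCocycle_apply_eq_zero_of_forall_primesAbove {w : HeightOneSpectrum (𝓞 K)}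
    (hwN : ∀ 𝔓 ∈ w.primesAbove, 𝔓.inertia (absoluteGaloisGroup K) ≤ N)
    (σ : absoluteGaloisGroup K) (n : ℕ) (y : contOneCocycles (subgroupRep X N))
    (hy : ∀ 𝔓 (h𝔓 : 𝔓 ∈ w.primesAbove) (τ : absoluteGaloisGroup K)
      (hτ : τ ∈ 𝔓.inertia (absoluteGaloisGroup K)), y.1 ⟨τ, hwN 𝔓 h𝔓 hτ⟩ = 0)
    (Φ : contOneCocycles X)
    (hΦ : ∀ u : N, Φ.1 u = ∑ i ∈ range n, (i : ℤ) • X.ρ (σ ^ i) (y.1 (subgroupConj N (σ ^ i) u)))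
    {𝔓 : Ideal (absIntegers (𝓞 K) K)} (h𝔓 : 𝔓 ∈ w.primesAbove) {τ : absoluteGaloisGroup K}
    (hτ : τ ∈ 𝔓.inertia (absoluteGaloisGroup K)) : Φ.1 τ = 0 := by
  refine derivCocycle_apply_eq_zero X N σ n y Φ hΦ ⟨τ, hwN 𝔓 h𝔓 hτ⟩ fun i => ?_
  -- `σ^{-i} τ σ^i ∈ I_{σ^{-i} • 𝔓}`, a prime above `w`
  have hconj : (σ ^ i)⁻¹ * τ * σ ^ i ∈ ((σ ^ i)⁻¹ • 𝔓).inertia (absoluteGaloisGroup K) := by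
    have h := conj_mem_inertia_smul hτ (σ ^ i)⁻¹
    rwa [inv_inv] at h
  have h := hy ((σ ^ i)⁻¹ • 𝔓) (smul_mem_primesAbove h𝔓 (σ ^ i)⁻¹) _ hconj
  have e : subgroupConj N (σ ^ i) ⟨τ, hwN 𝔓 h𝔓 hτ⟩ =
      ⟨(σ ^ i)⁻¹ * τ * σ ^ i, hwN _ (smul_mem_primesAbove h𝔓 (σ ^ i)⁻¹) hconj⟩ :=
    Subtype.ext (subgroupConj_apply_coe N (σ ^ i) _)
  rw [e]
  exact h

omit [NumberField K] [N.Normal] in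
/-- **Class-level input**: if every `I_𝔓`, `𝔓 ∣ w`, lies in `N` and acts trivially on `X`, and the
class of `y` restricts to zero on each `N ⊓ I_𝔓` (Kato's integrality: `Kato2004.integralH1`), then
`y` vanishes at every element of every `I_𝔓` (p451028 `apply_eq_zero_of_resLe_inf_eq_zero`).
[cite: Rubin2000, Thm. 4.5.1] -/
theorem forall_primesAbove_apply_eq_zero_of_resLe_inf_eq_zero {w : HeightOneSpectrum (𝓞 K)}
    (hwN : ∀ 𝔓 ∈ w.primesAbove, 𝔓.inertia (absoluteGaloisGroup K) ≤ N)
    (hX : ∀ 𝔓 ∈ w.primesAbove, ∀ τ ∈ 𝔓.inertia (absoluteGaloisGroup K), ∀ x : X, X.ρ τ x = x)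
    (y : contOneCocycles (subgroupRep X N))
    (hres : ∀ 𝔓 ∈ w.primesAbove, resLe X
      (inf_le_left : N ⊓ 𝔓.inertia (absoluteGaloisGroup K) ≤ N) 1 (oneCocycleClass _ y) = 0) :
    ∀ 𝔓 (h𝔓 : 𝔓 ∈ w.primesAbove) (τ : absoluteGaloisGroup K)
      (hτ : τ ∈ 𝔓.inertia (absoluteGaloisGroup K)), y.1 ⟨τ, hwN 𝔓 h𝔓 hτ⟩ = 0 :=
  fun 𝔓 h𝔓 τ hτ =>
    apply_eq_zero_of_resLe_inf_eq_zero X N (𝔓.inertia (absoluteGaloisGroup K)) (hX 𝔓 h𝔓) y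
      (hres 𝔓 h𝔓) ⟨τ, hwN 𝔓 h𝔓 hτ⟩ hτ

end Global

/-! ### §2 Local: `loc_w [Φ] ∈ H¹_ur(K_w, M)` -/

section Local

variable {K : Type u} [Field K] [NumberField K] {M : Type u} [AddCommGroup M] [TopologicalSpace M]
  [DiscreteTopology M] (ρ : DiscreteGaloisModule K M) (w : HeightOneSpectrum (𝓞 K))
  [ValuativeRel (w.adicCompletion K)] [IsNonarchimedeanLocalField (w.adicCompletion K)]

/-- **A global cocycle vanishing on the inertia group of the distinguished prime `𝔓₀ ∣ w` has
unramified localisation at `w`**: `loc_w [Φ] ∈ H¹_ur(K_w, M) = ker (H¹(K_w, M) → H¹(K_w^{nr}, M))`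
— `loc_w [Φ] = [Φ ∘ res]` (`galoisCohomology.res_one_oneCocycleClass`), `res (I_{K_w}) = I_{𝔓₀}`
(`inertia_adicCompletionPrime_eq_map_absInertia`), and a cocycle vanishing on `I_{K_w}` is unramified
(x11b `LocBridge.mem_unramifiedSubgroup_one_iff_exists` with `w = 0`).
[cite: MilneADT2006, Ch. I §2 (unramified cohomology)] [cite: NeukirchANT1999, Ch. II §9 Prop. (9.6)] -/
theorem localization_mem_unramifiedSubgroup_of_forall_inertia_apply_eq_zero
    (Φ : contOneCocycles ρ.toTopRep)
    (hΦ : ∀ τ ∈ (adicCompletionPrime K w).inertia (absoluteGaloisGroup K), Φ.1 τ = 0) :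
    galoisCohomology.localization ρ (Sum.inr w) 1 (oneCocycleClass ρ.toTopRep Φ) ∈
      DiscreteGaloisModule.unramifiedSubgroup (GaloisRep.toLocal w ρ) 1 := by
  have hloc : galoisCohomology.localization ρ (Sum.inr w) 1 (oneCocycleClass ρ.toTopRep Φ) =
      oneCocycleClass (GaloisRep.toLocal w ρ).toTopRep
        (contOneCocycles.pullback (absGaloisRestrict K (w.adicCompletion K)) (X := ρ.toTopRep)
          (Y := (GaloisRep.toLocal w ρ).toTopRep)
          (TopRep.ofHom ⟨ContinuousLinearMap.id ℤ M, fun _ => rfl⟩) Φ) :=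
    galoisCohomology.res_one_oneCocycleClass (w.adicCompletion K) Φ
  have key : oneCocycleClass (GaloisRep.toLocal w ρ).toTopRep
        (contOneCocycles.pullback (absGaloisRestrict K (w.adicCompletion K)) (X := ρ.toTopRep)
          (Y := (GaloisRep.toLocal w ρ).toTopRep)
          (TopRep.ofHom ⟨ContinuousLinearMap.id ℤ M, fun _ => rfl⟩) Φ) ∈
      DiscreteGaloisModule.unramifiedSubgroup (GaloisRep.toLocal w ρ) 1 := by
    rw [X11b.LocBridge.mem_unramifiedSubgroup_one_iff_exists]
    refine ⟨0, fun τ hτ => ?_⟩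
    rw [contOneCocycles.pullback_apply, map_zero, sub_zero]
    refine hΦ _ ?_
    rw [inertia_adicCompletionPrime_eq_map_absInertia]
    exact Subgroup.mem_map_of_mem _ hτ
  exact hloc ▸ key

variable (N : Subgroup (absoluteGaloisGroup K)) [N.Normal]

/-- **MU-TRANSFER-PROOF §3 Lemma 2, "`κ_q` unramified at `ℓ ∤ pNq`", in the LOCAL currency of the
meeting point** (x10 `StepFour.convCoeff_eq_zero_of_qTermIdentity`, hypothesis `hx`): with
`X = ρ.toTopRep`, a global cocycle `Φ` whose restriction to `N` is the derivative cocycle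
`Σ_{i<n} i•σ^i·y` of an `N`-cocycle `y` that is UNRAMIFIED at `w` (`res_{N ⊓ I_𝔓}[y] = 0` for all
`𝔓 ∣ w`), at a place `w` where `N` is unramified (`I_𝔓 ≤ N`, e.g. `w ∤ ℓ` for `N = Gal(K̄/K(μ_ℓ))`:
`rootsOfUnityFixer_unramifiedAt`) and `ρ` is unramified, has `loc_w [Φ] ∈ H¹_ur(K_w, M)`.
[cite: Rubin2000, Thm. 4.5.1] [cite: MazurRubin2004, App. A Prop. A.2 and Remark A.5 (pp. 79–81)] -/
theorem localization_derivCocycle_mem_unramifiedSubgroup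
    (hwN : ∀ 𝔓 ∈ w.primesAbove, 𝔓.inertia (absoluteGaloisGroup K) ≤ N)
    (hunr : GaloisRep.IsUnramifiedAt w ρ)
    (σ : absoluteGaloisGroup K) (n : ℕ) (y : contOneCocycles (subgroupRep ρ.toTopRep N))
    (hres : ∀ 𝔓 ∈ w.primesAbove, resLe ρ.toTopRep
      (inf_le_left : N ⊓ 𝔓.inertia (absoluteGaloisGroup K) ≤ N) 1 (oneCocycleClass _ y) = 0)
    (Φ : contOneCocycles ρ.toTopRep)
    (hΦ : ∀ u : N, Φ.1 u =
      ∑ i ∈ range n, (i : ℤ) • ρ.toTopRep.ρ (σ ^ i) (y.1 (subgroupConj N (σ ^ i) u))) :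
    galoisCohomology.localization ρ (Sum.inr w) 1 (oneCocycleClass ρ.toTopRep Φ) ∈
      DiscreteGaloisModule.unramifiedSubgroup (GaloisRep.toLocal w ρ) 1 := by
  have hX : ∀ 𝔓 ∈ w.primesAbove, ∀ τ ∈ 𝔓.inertia (absoluteGaloisGroup K), ∀ x : ρ.toTopRep,
      ρ.toTopRep.ρ τ x = x := fun 𝔓 h𝔓 τ hτ x => by
    change ρ τ x = x
    rw [hunr 𝔓 h𝔓 τ hτ]
    rfl
  have hy := forall_primesAbove_apply_eq_zero_of_resLe_inf_eq_zero ρ.toTopRep N hwN hX y hres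
  exact localization_mem_unramifiedSubgroup_of_forall_inertia_apply_eq_zero ρ w Φ fun τ hτ =>
    derivCocycle_apply_eq_zero_of_forall_primesAbove ρ.toTopRep N hwN σ n y hy Φ hΦ
      (adicCompletionPrime_mem_primesAbove K w) hτ

end Local

end Summit.BirchSwinnertonDyer.BirchSwinnertonDyer.Rank1Residual.KolyvaginTwist

end
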